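import Summits.BirchSwinnertonDyer.BirchSwinnertonDyer.Theorems.AlignedTransportAtTwoMainConjectureOfRankZeroBSDAtTwoSelmerTwoOfBSDp
import Summits.BirchSwinnertonDyer.BirchSwinnertonDyer.Theorems.GenusKolyvaginAtTwoCasselsTateNumberField
import Literature.NumberTheory.EllipticCurves.TwoSelmerCubicTwoTorsionFieldClassGroup
import Mathlib.NumberTheory.NumberField.ClassNumber
import HarnessLib

/-!
# Route `AlignedTransportAtTwo`, crux C2 `MainConjectureOfRankZeroBSDAtTwo` (stmt-BirchSwinnertonDyer-22298):
# THE PARITY OF `h(ℚ(β))` IS THE PARITY OF `L(W,1)/Ω_W` — granted `BSD₂(W)` and the printed two-sided Brumer–Kramer / Yoo–Yu bound,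
# on the cubic cell {good ordinary at `2`, `E(ℚ)[2] = 0`, `Δ_W < 0`, `∏ c_v` odd, `r_an = 0`}:
# **`ord₂(L(W,1)/Ω_W) = 0 ⟺ 2 ∤ h(ℚ(β))`**, and `ord₂(L(W,1)/Ω_W) ≥ 1 ⟹ 2 ∣ h(ℚ(β))` (the `2045b1` prediction, `#Ш_an = 16`)

HONEST FRAMING (cell `bsd-f1-sign2`, WIDTH-5 attached prover seat `bsd-line-att-p5` gen 30 on line `birth` of the lead `bsd-line-att-p2`;
`--supports` stmt-BirchSwinnertonDyer-22298, closes nothing; BSD is NOT proved by any of this; the crux C2, its verdict «blocked-on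
`Rank1Residual.GreenbergMuConjectureIrreducible`» and every registered stub are untouched). THEOREMS ONLY (no definition, no `sorry`); the ONE
NAMED FACT displayed is `Literature.NumberTheory.EllipticCurves.yooYu_card_selmerTwo_bounds_cubicTwoTorsionField` (Yoo–Yu 2022 Thm. 1.6, BOTH
bounds, `K = ℚ`, `Δ < 0`: `#(C_L/C_L²) ≤ #Sel₂(E_W/ℚ) ≤ 2·#(C_L/C_L²)`, `L = ℚ(β)`; statement-only file
`Literature/NumberTheory/EllipticCurves/TwoSelmerCubicTwoTorsionFieldClassGroup.lean`, this gen), plus the crux's own `BSD₂(W)` (Miller) as a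
hypothesis. Every other input is a tree theorem: the exact `2`-descent count `#Sel₂ = 2^r·#E(ℚ)[2]·#Ш[2]` (`natCard_selmerGroup_eq`, Silverman
X.4.2), Cassels–Tate UNCONDITIONALLY (`GenusExact.CasselsTateNumberField.isSquare_natCard_sha_torsionBy_pow`, gk2-p1: `#Ш[2]` is a square once
`Ш[2^∞]` is finite), and this gen's `…SelmerTwoOfBSDp`.

WHAT.
* §1 finite commutative groups: `2 ≤ #(G/G²) ⟹ 2 ∣ #G` and `#(G/G²) ≤ 1 ⟹ 2 ∤ #G` (`G² = (powMonoidHom 2).range`, the tree's `rank₂` currency).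
* §2 `yooYu_selmerTwo_eq_bot_oddClassNumber_of_bounds`: the two-sided fact IMPLIES att-p5 g29's special-shape fact
  `yooYu_selmerTwo_eq_bot_oddClassNumber_cubicTwoTorsionField` (consistency of the two named facts; the older one is now redundant given the new).
* §3 `four_le_natCard_sha_torsionBy_two_of_bsdp`: `BSDp W 2` and `#Ш_an(W) = q` with `ord₂ q ≠ 0` ⟹ `4 ≤ #Ш(W)[2]` (Miller's clause makes
  `Ш[2^∞] ≠ 0`; Cauchy gives a class of order `2`; Cassels–Tate makes `#Ш[2]` a square `> 1`).
* §4 `four_le_natCard_selmerTwo_of_bsdp_of_lValue`: + `r_an = 0` + `ht` + `Odd (∏ c_v)` + `L(W,1)/Ω_W = q`, `ord₂ q ≠ 0` ⟹ `4 ≤ #Sel₂(W/ℚ)`.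
* §5 ★ `two_dvd_card_classGroup_adjoin_of_bsdp_of_padicValRat_lValue_ne_zero`: + `hYY2` (+ good ordinary, `Δ_W < 0`) ⟹ **`2 ∣ h(ℚ(β))`**;
  ★ `padicValRat_lValue_eq_zero_iff_not_two_dvd_card_classGroup_adjoin`: **`ord₂(L(W,1)/Ω_W) = 0 ⟺ 2 ∤ h(ℚ(β))`** on the cell, granted
  `BSD₂(W)` + `hYY2`; Zhai-currency forms (`IsLAlg`, `Ω_∞ = Ω_W` on `Δ_W < 0`).

READING (planner-of-record / -data / -desc). On the off-stratum `Δ_W < 0` cubic road the `(0,1)` CLASS-NUMBER certificate rows (g28) need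
`2 ∤ h(ℚ(β))`; by §5 that bit IS the parity of the algebraic `L`-value under C2's own `BSD₂(W)`: a seed with `v₂(L/Ω) ≥ 1` (e.g. `2045b1`,
`#Ш_an = 16`, `v₂ = 4` in X5-AT2-TABLE v1.2) has EVEN `h(ℚ(β))` and its class-number rows can never fire — only RANK-form or higher-layer
certificates remain there; a seed with odd `L/Ω` has ODD `h(ℚ(β))` and the cubic Chevalley door reduces to the `2`-adic sign of one unit
(`…CubicChevalleyLValueBit`). CONDITIONAL (BSD₂(W), `hYY2` displayed); nothing is asserted about any curve; nothing closed; BSD is not proved.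

References: [YooYu2022] Thm. 1.4, 1.6, 1.10, 1.11 (1), Remark 2.4 (§2.1); [BrumerKramer1977] §7; [Miller2011LMS] Def. 1.1; [SilvermanAEC2009] Thm. X.4.2,
X.4.14; [Cassels1962ArithmeticIV] §1; tree: gk2-p1 `…GenusKolyvaginAtTwoCasselsTateNumberField`, `BSDRankZeroDensityProofs`
(`natCard_selmerGroup_eq`), att-p5 g29 `TwoSelmerCubicTwoTorsionFieldClassGroup`, g30 `…SelmerTwoOfBSDp`.
-/

set_option linter.dupNamespace false
set_option autoImplicit false

noncomputable section

open scoped Classical NumberField AddSubgroup IntermediateField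

namespace Summit.BirchSwinnertonDyer.BirchSwinnertonDyer.Theorems.AlignedTransportAtTwoCubicClassNumberParityOfLValue

open WeierstrassCurve NumberField Polynomial IntermediateField Literature.NumberTheory.EllipticCurves
  Literature.NumberTheory.EllipticCurves.Rank1Residual Literature.NumberTheory.EllipticCurves.Greenberg1999
  Literature.NumberTheory.EllipticCurves.Zhai2016
  Summit.BirchSwinnertonDyer.BirchSwinnertonDyer.Theorems.GenusExact
  Summit.BirchSwinnertonDyer.BirchSwinnertonDyer.Theorems.AlignedTransportAtTwoSelmerTwoOfBSDp

/-! ## §1 Finite commutative groups: `2 ∣ #G ⟺ G ≠ G²` in the `#(G/G²)` currency -/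

section Groups

variable {G : Type*} [CommGroup G] [Finite G]

omit [Finite G] in
/-- **`2 ≤ #(G/G²) ⟹ 2 ∣ #G`** for a (finite) commutative group `G` (`G² = (powMonoidHom 2).range`): if `#G` were odd, squaring would be a
bijection (`powCoprime`), so `G² = G` and the quotient is trivial. [folklore] -/
theorem two_dvd_natCard_of_two_le_natCard_quotient_range_powMonoidHom_two
    (h : 2 ≤ Nat.card (G ⧸ (powMonoidHom 2 : G →* G).range)) : 2 ∣ Nat.card G := by
  by_contra hnd
  have hcop : (Nat.card G).Coprime 2 := (Nat.coprime_comm).mp ((Nat.Prime.coprime_iff_not_dvd Nat.prime_two).mpr hnd)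
  have htop : (powMonoidHom 2 : G →* G).range = ⊤ := by
    rw [eq_top_iff]
    intro g _
    refine ⟨(powCoprime hcop).symm g, ?_⟩
    rw [powMonoidHom_apply, ← powCoprime_apply hcop, Equiv.apply_symm_apply]
  haveI : Subsingleton (G ⧸ (powMonoidHom 2 : G →* G).range) := by
    rw [htop]; exact QuotientGroup.subsingleton_quotient_top
  have h1 : Nat.card (G ⧸ (powMonoidHom 2 : G →* G).range) = 1 := Nat.card_of_subsingleton (1 : G ⧸ _)
  omega

/-- **`#(G/G²) ≤ 1 ⟹ 2 ∤ #G`** for a finite commutative group `G`: otherwise Cauchy gives `g` of order `2`; but `G² = G` makes squaring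
surjective, hence injective on the finite `G`, and `g² = 1 = 1²` forces `g = 1`. [folklore] -/
theorem not_two_dvd_natCard_of_natCard_quotient_range_powMonoidHom_two_le_one
    (h : Nat.card (G ⧸ (powMonoidHom 2 : G →* G).range) ≤ 1) : ¬ 2 ∣ Nat.card G := by
  intro hdvd
  obtain ⟨g, hg⟩ := exists_prime_orderOf_dvd_card' (G := G) 2 hdvd
  have h1 : Nat.card (G ⧸ (powMonoidHom 2 : G →* G).range) = 1 := le_antisymm h Nat.card_pos
  haveI : Subsingleton (G ⧸ (powMonoidHom 2 : G →* G).range) := (Nat.card_eq_one_iff_unique.mp h1).1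
  have hsurj : Function.Surjective (powMonoidHom 2 : G →* G) := by
    intro y
    have hy : y ∈ (powMonoidHom 2 : G →* G).range := by
      rw [← QuotientGroup.eq_one_iff]; exact Subsingleton.elim _ _
    exact hy
  have hinj : Function.Injective (powMonoidHom 2 : G →* G) := Finite.injective_iff_surjective.mpr hsurj
  have hg2 : g ^ 2 = 1 := by rw [← hg]; exact pow_orderOf_eq_one g
  have hg1 : g = 1 := hinj (by rw [powMonoidHom_apply, powMonoidHom_apply, hg2, one_pow])
  rw [hg1, orderOf_one] at hg
  exact absurd hg (by norm_num)

end Groups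

/-! ## §2 The two-sided Yoo–Yu fact implies the special-shape fact of att-p5 g29 -/

/-- **Consistency of the two named facts**: the two-sided bound `#(C_L/C_L²) ≤ #Sel₂ ≤ 2·#(C_L/C_L²)` (this gen) IMPLIES the special shape
`Sel₂(E_W/ℚ) = 0 ⟹ 2 ∤ h(ℚ(β))` recorded by att-p5 g29 (lower bound with `#Sel₂ = 1`, then §1). [cite: YooYu2022, Thm. 1.6 with Thm. 1.4 / 1.10 / 1.11 (1)] -/
theorem yooYu_selmerTwo_eq_bot_oddClassNumber_of_bounds (hYY2 : yooYu_card_selmerTwo_bounds_cubicTwoTorsionField) :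
    yooYu_selmerTwo_eq_bot_oddClassNumber_cubicTwoTorsionField := by
  intro W _ _ hord ht hΔ htam hSel β hβ
  have hβint : IsIntegral ℚ β := ((AlgebraicClosure.isAlgebraic ℚ).isAlgebraic β).isIntegral
  haveI : FiniteDimensional ℚ ↥(IntermediateField.adjoin ℚ ({β} : Set (AlgebraicClosure ℚ))) := IntermediateField.adjoin.finiteDimensional hβint
  haveI : NumberField ↥(IntermediateField.adjoin ℚ ({β} : Set (AlgebraicClosure ℚ))) := NumberField.mk
  obtain ⟨hlow, -⟩ := hYY2 W hord ht hΔ htam hβ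
  have h1 : Nat.card (W.selmerGroup 2) = 1 := by rw [hSel]; exact AddSubgroup.card_bot
  rw [h1] at hlow
  exact not_two_dvd_natCard_of_natCard_quotient_range_powMonoidHom_two_le_one hlow

/-! ## §3 `BSD(W,2)` at a non-unit `#Ш_an` forces `#Ш(W)[2] ≥ 4` (Miller's clause + Cauchy + Cassels–Tate) -/

variable (W : WeierstrassCurve ℚ) [W.IsElliptic]

omit [W.IsElliptic] in
/-- Transport: the `n`-torsion of the group `Ш(W)` and the subgroup `Ш(W) ⊓ H¹(ℚ,E)[n]` of `H¹(ℚ,E)` have the same cardinality. [folklore] -/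
theorem natCard_torsionBy_sha_eq_natCard_sha_inf_torsionBy (n : ℕ) :
    Nat.card (AddSubgroup.torsionBy W.sha n) = Nat.card (W.sha ⊓ AddSubgroup.torsionBy W.galH1 n : AddSubgroup W.galH1) := by
  refine Nat.card_congr
    { toFun := fun x => ⟨((x : W.sha) : W.galH1), AddSubgroup.mem_inf.mpr ⟨(x : W.sha).2, ?_⟩⟩
      invFun := fun y => ⟨⟨(y : W.galH1), (AddSubgroup.mem_inf.mp y.2).1⟩, ?_⟩
      left_inv := fun x => Subtype.ext (Subtype.ext rfl)
      right_inv := fun y => Subtype.ext rfl }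
  · have hx : n • (x : W.sha) = 0 := AddSubgroup.torsionBy.nsmul_iff.mp x.2
    refine AddSubgroup.torsionBy.nsmul_iff.mpr ?_
    rw [← AddSubgroupClass.coe_nsmul, hx, ZeroMemClass.coe_zero]
  · have hy : n • (y : W.galH1) = 0 := AddSubgroup.torsionBy.nsmul_iff.mp (AddSubgroup.mem_inf.mp y.2).2
    refine AddSubgroup.torsionBy.nsmul_iff.mpr (Subtype.ext ?_)
    rw [AddSubgroupClass.coe_nsmul, ZeroMemClass.coe_zero]
    exact hy

/-- **`BSDp W 2` with `ord₂ #Ш_an(W) ≠ 0` ⟹ `4 ≤ #Ш(W)[2]`.** Miller's clause gives `ord₂ #Ш[2^∞] = ord₂ #Ш_an ≠ 0`, so the finite `2`-group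
`Ш[2^∞]` is non-trivial and (Cauchy) contains a class of order `2`: `Ш[2] ≠ 0`; by Cassels–Tate (unconditional tree theorem
`CasselsTateNumberField.isSquare_natCard_sha_torsionBy_pow`) `#Ш[2]` is a square, hence `≥ 4`. [cite: Miller2011LMS, Def. 1.1]
[cite: SilvermanAEC2009, Thm. X.4.14] [cite: Cassels1962ArithmeticIV, §1] -/
theorem four_le_natCard_sha_torsionBy_two_of_bsdp (hbsd : BSDp W 2) {q : ℚ} (hq : shaAn W = (q : ℂ)) (hv : padicValRat 2 q ≠ 0) :
    4 ≤ Nat.card (AddSubgroup.torsionBy W.sha (2 : ℕ)) := by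
  obtain ⟨-, hfin, q', hq', hval⟩ := hbsd
  haveI := hfin
  have hqq : q' = q := by exact_mod_cast hq'.symm.trans hq
  subst hqq
  -- `2 ∣ #Ш[2^∞]`
  have hdvd : 2 ∣ Nat.card (AddCommGroup.primaryComponent W.sha 2) := by
    by_contra hnd
    rw [hval, padicValNat.eq_zero_of_not_dvd hnd, Nat.cast_zero] at hv
    exact hv rfl
  -- a class of order `2`
  obtain ⟨x, hx⟩ := exists_prime_addOrderOf_dvd_card' (G := AddCommGroup.primaryComponent W.sha 2) 2 hdvd
  have hx0 : (x : W.sha) ≠ 0 := by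
    intro h0
    have : x = 0 := Subtype.ext h0
    rw [this, addOrderOf_zero] at hx
    exact absurd hx (by norm_num)
  have hx2 : (2 : ℕ) • (x : W.sha) = 0 := by
    have h := addOrderOf_nsmul_eq_zero x
    rw [hx] at h
    rw [← AddSubgroupClass.coe_nsmul, h, ZeroMemClass.coe_zero]
  -- `Ш[2] ⊆ Ш[2^∞]` is finite and non-trivial
  have hsub : ∀ y : W.sha, y ∈ AddSubgroup.torsionBy W.sha (2 : ℕ) → y ∈ AddCommGroup.primaryComponent W.sha 2 := fun y hy =>
    (AddCommGroup.mem_primaryComponent).mpr ⟨1, by rw [pow_one]; exact AddSubgroup.torsionBy.nsmul_iff.mp hy⟩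
  haveI : Finite (AddSubgroup.torsionBy W.sha (2 : ℕ)) :=
    Finite.of_injective (fun y => (⟨y.1, hsub y.1 y.2⟩ : AddCommGroup.primaryComponent W.sha 2))
      (fun a b hab => by
        simp only [Subtype.mk.injEq] at hab
        exact Subtype.ext hab)
  have hxmem : (x : W.sha) ∈ AddSubgroup.torsionBy W.sha (2 : ℕ) := AddSubgroup.torsionBy.nsmul_iff.mpr hx2
  haveI : Nontrivial (AddSubgroup.torsionBy W.sha (2 : ℕ)) := ⟨⟨⟨(x : W.sha), hxmem⟩, 0, fun h => hx0 (congrArg Subtype.val h)⟩⟩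
  have h2 : 1 < Nat.card (AddSubgroup.torsionBy W.sha (2 : ℕ)) := Finite.one_lt_card
  -- Cassels–Tate: a square
  have hsq : IsSquare (Nat.card (AddSubgroup.torsionBy W.sha (2 : ℕ))) := by
    have h := CasselsTateNumberField.isSquare_natCard_sha_torsionBy_pow W 2 1
    rwa [pow_one] at h
  obtain ⟨r, hr⟩ := hsq
  rw [hr] at h2 ⊢
  have hr2 : 2 ≤ r := by
    by_contra hlt
    have hle : r ≤ 1 := by omega
    interval_cases r <;> simp at h2
  nlinarith

/-! ## §4 Hence `#Sel₂(W/ℚ) ≥ 4` in analytic rank zero at a non-unit `L`-value -/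

/-- `E(ℚ)[2] = 0` from the binder `ht` as a cardinality: `#E(ℚ)[2] = 1`. [cite: SilvermanAEC2009, III.2.3] -/
theorem natCard_torsionBy_point_two_eq_one (ht : ∀ x : ℚ, ¬ HasRationalTwoTorsionX W x) :
    Nat.card (AddSubgroup.torsionBy W.toAffine.Point (2 : ℕ)) = 1 := by
  have h0 := forall_zsmul_eq_zero_of_irr W 2 (irr_two_of_forall_not_hasRationalTwoTorsionX W ht)
  haveI : Subsingleton (AddSubgroup.torsionBy W.toAffine.Point (2 : ℕ)) := ⟨fun a b => Subtype.ext <| by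
    have ha := h0 a.1 (by rw [natCast_zsmul]; exact AddSubgroup.torsionBy.nsmul_iff.mp a.2)
    have hb := h0 b.1 (by rw [natCast_zsmul]; exact AddSubgroup.torsionBy.nsmul_iff.mp b.2)
    rw [ha, hb]⟩
  exact Nat.card_of_subsingleton (0 : AddSubgroup.torsionBy W.toAffine.Point (2 : ℕ))

/-- **`BSDp W 2`, `r_an(W) = 0`, no rational `2`-torsion abscissa, `#Ш_an(W) = q` with `ord₂ q ≠ 0` ⟹ `4 ≤ #Sel₂(W/ℚ)`**: the exact
`2`-descent count `#Sel₂ = 2^r · #E(ℚ)[2] · #Ш[2]` (Silverman X.4.2, tree `natCard_selmerGroup_eq`) with `r = 0`, `#E(ℚ)[2] = 1`, and §3.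
[cite: SilvermanAEC2009, Thm. X.4.2] [cite: Miller2011LMS, Def. 1.1] -/
theorem four_le_natCard_selmerTwo_of_bsdp_of_shaAn (hbsd : BSDp W 2) (hr : W.analyticRank = 0)
    (ht : ∀ x : ℚ, ¬ HasRationalTwoTorsionX W x) {q : ℚ} (hq : shaAn W = (q : ℂ)) (hv : padicValRat 2 q ≠ 0) :
    4 ≤ Nat.card (W.selmerGroup 2) := by
  have hr0 : W.mordellWeilRank = 0 := hbsd.1.trans hr
  have h4 := four_le_natCard_sha_torsionBy_two_of_bsdp W hbsd hq hv
  rw [natCard_torsionBy_sha_eq_natCard_sha_inf_torsionBy] at h4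
  have h1 := natCard_torsionBy_point_two_eq_one W ht
  -- the tree's count carries the classical `DecidableEq` instance on `E(ℚ)`; `convert` bridges the (subsingleton) instance
  have hcard : Nat.card (W.selmerGroup (2 : ℕ)) = 2 ^ W.mordellWeilRank * Nat.card (AddSubgroup.torsionBy W.toAffine.Point (2 : ℕ)) *
      Nat.card (W.sha ⊓ AddSubgroup.torsionBy W.galH1 (2 : ℕ) : AddSubgroup W.galH1) := by
    convert W.natCard_selmerGroup_eq (n := 2) two_ne_zero
  rw [hr0, pow_zero, one_mul, h1, one_mul] at hcard
  rw [← hcard] at h4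
  exact h4

/-- **The `L`-value form**: `BSDp W 2`, `r_an = 0`, `ht`, `Odd (∏ c_v)`, `L(W,1)/Ω_W = q` with `ord₂ q ≠ 0` ⟹ `4 ≤ #Sel₂(W/ℚ)` (in analytic rank
`0`, `ord₂ #Ш_an = ord₂ (L(W,1)/Ω_W)` when `#E(ℚ)_tors` and `∏ c_v` are odd — `…SelmerTwoOfBSDp` §3). [cite: SilvermanAEC2009, Thm. X.4.2]
[cite: Miller2011LMS, §1 and Def. 1.1] -/
theorem four_le_natCard_selmerTwo_of_bsdp_of_lValue (hbsd : BSDp W 2) (hr : W.analyticRank = 0)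
    (ht : ∀ x : ℚ, ¬ HasRationalTwoTorsionX W x) (htam : Odd W.tamagawaProduct) {q : ℚ}
    (hL : W.entireLFunction 1 / (W.realPeriodRat : ℂ) = (q : ℂ)) (hv : padicValRat 2 q ≠ 0) :
    4 ≤ Nat.card (W.selmerGroup 2) := by
  have hq0 : q ≠ 0 := by rintro rfl; exact hv padicValRat.zero
  have hr0 : W.mordellWeilRank = 0 := hbsd.1.trans hr
  refine four_le_natCard_selmerTwo_of_bsdp_of_shaAn W hbsd hr ht (shaAn_eq_of_analyticRank_eq_zero_of_lValue W hr0 hr hL) ?_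
  rwa [padicValRat_shaAn_eq_of_lValue W 2 (irr_two_of_forall_not_hasRationalTwoTorsionX W ht)
    (not_two_dvd_tamagawaProduct_of_odd W htam) hq0]

/-! ## §5 ★ The parity of `h(ℚ(β))` is the parity of `L(W,1)/Ω_W` (granted `BSD₂(W)` and the two-sided Yoo–Yu bound) -/

section Parity

variable [W.IsGloballyMinimal]

/-- **★ EVEN ALGEBRAIC `L`-VALUE ⟹ EVEN CLASS NUMBER OF THE CUBIC `2`-TORSION FIELD.** For `W/ℚ` globally minimal, good ordinary at `2`, no
rational `2`-torsion abscissa, `Δ_W < 0`, `Odd (∏_v c_v)`, `r_an(W) = 0`, granted `BSD₂(W)` (`hbsd`) and Yoo–Yu's two-sided bound (`hYY2`): if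
`L(W,1)/Ω_W = q` with `ord₂ q ≠ 0` then `2 ∣ #Cl(ℚ(β))` for every root `β` of the `2`-division cubic. (`4 ≤ #Sel₂ ≤ 2·#(C_L/C_L²)` forces
`C_L ≠ C_L²`.) The `2045b1` prediction: `#Ш_an = 16` there, so `h(ℚ(β))` is EVEN and the `(0,1)` class-number rows of g28 cannot fire.
[cite: YooYu2022, Thm. 1.6 with Thm. 1.4 / 1.10 / 1.11 (1)] [cite: Miller2011LMS, Def. 1.1] [cite: SilvermanAEC2009, Thm. X.4.2 and X.4.14] -/
theorem two_dvd_card_classGroup_adjoin_of_bsdp_of_padicValRat_lValue_ne_zero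
    (hYY2 : yooYu_card_selmerTwo_bounds_cubicTwoTorsionField)
    (hord : IsOrdinaryAt W 2) (ht : ∀ x : ℚ, ¬ HasRationalTwoTorsionX W x) (hΔ : W.Δ < 0) (htam : Odd W.tamagawaProduct)
    (hr : W.analyticRank = 0) (hbsd : BSDp W 2) {q : ℚ}
    (hL : W.entireLFunction 1 / (W.realPeriodRat : ℂ) = (q : ℂ)) (hv : padicValRat 2 q ≠ 0)
    {β : AlgebraicClosure ℚ} (hβ : aeval β W.twoTorsionPolynomial.toPoly = 0) :
    2 ∣ Nat.card (ClassGroup (𝓞 ↥(IntermediateField.adjoin ℚ ({β} : Set (AlgebraicClosure ℚ))))) := by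
  have hβint : IsIntegral ℚ β := ((AlgebraicClosure.isAlgebraic ℚ).isAlgebraic β).isIntegral
  haveI : FiniteDimensional ℚ ↥(IntermediateField.adjoin ℚ ({β} : Set (AlgebraicClosure ℚ))) := IntermediateField.adjoin.finiteDimensional hβint
  haveI : NumberField ↥(IntermediateField.adjoin ℚ ({β} : Set (AlgebraicClosure ℚ))) := NumberField.mk
  obtain ⟨-, hup⟩ := hYY2 W hord ht hΔ htam hβ
  have h4 := four_le_natCard_selmerTwo_of_bsdp_of_lValue W hbsd hr ht htam hL hv
  exact two_dvd_natCard_of_two_le_natCard_quotient_range_powMonoidHom_two (by omega)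

/-- **★ THE DICHOTOMY: `ord₂(L(W,1)/Ω_W) = 0 ⟺ 2 ∤ h(ℚ(β))`** on the cell {globally minimal, good ordinary at `2`, no rational `2`-torsion
abscissa, `Δ_W < 0`, `Odd (∏ c_v)`, `r_an = 0`}, granted `BSD₂(W)` and the two-sided Yoo–Yu bound, for any non-zero rational value `q` of
`L(W,1)/Ω_W`. (`⟹`: `Sel₂(W/ℚ) = ⊥` by `…SelmerTwoOfBSDp`, then the lower bound; `⟸`: the previous theorem.)
[cite: YooYu2022, Thm. 1.6 with Thm. 1.4 / 1.10 / 1.11 (1)] [cite: Miller2011LMS, Def. 1.1] [cite: SilvermanAEC2009, Thm. X.4.2 and X.4.14] -/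
theorem padicValRat_lValue_eq_zero_iff_not_two_dvd_card_classGroup_adjoin
    (hYY2 : yooYu_card_selmerTwo_bounds_cubicTwoTorsionField)
    (hord : IsOrdinaryAt W 2) (ht : ∀ x : ℚ, ¬ HasRationalTwoTorsionX W x) (hΔ : W.Δ < 0) (htam : Odd W.tamagawaProduct)
    (hr : W.analyticRank = 0) (hbsd : BSDp W 2) {q : ℚ} (hq0 : q ≠ 0)
    (hL : W.entireLFunction 1 / (W.realPeriodRat : ℂ) = (q : ℂ))
    {β : AlgebraicClosure ℚ} (hβ : aeval β W.twoTorsionPolynomial.toPoly = 0) :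
    padicValRat 2 q = 0 ↔ ¬ 2 ∣ Nat.card (ClassGroup (𝓞 ↥(IntermediateField.adjoin ℚ ({β} : Set (AlgebraicClosure ℚ))))) := by
  refine ⟨fun hv => ?_, fun hodd => ?_⟩
  · have hSel : W.selmerGroup 2 = ⊥ := selmerGroup_two_eq_bot_of_bsdp W hbsd hr ht htam ⟨q, hq0, hL, hv⟩
    exact yooYu_selmerTwo_eq_bot_oddClassNumber_of_bounds hYY2 W hord ht hΔ htam hSel hβ
  · by_contra hv
    exact hodd (two_dvd_card_classGroup_adjoin_of_bsdp_of_padicValRat_lValue_ne_zero W hYY2 hord ht hΔ htam hr hbsd hL hv hβ)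

/-- **The class-number form of `Sel₂`**: on the same cell, granted `BSD₂(W)` + `hYY2`, `Sel₂(W/ℚ) = ⊥ ⟺ 2 ∤ h(ℚ(β))`.
[cite: YooYu2022, Thm. 1.6 with Thm. 1.4 / 1.10 / 1.11 (1)] [cite: Miller2011LMS, Def. 1.1] [cite: SilvermanAEC2009, Thm. X.4.2 and X.4.14] -/
theorem selmerGroup_two_eq_bot_iff_not_two_dvd_card_classGroup_adjoin
    (hYY2 : yooYu_card_selmerTwo_bounds_cubicTwoTorsionField)
    (hord : IsOrdinaryAt W 2) (ht : ∀ x : ℚ, ¬ HasRationalTwoTorsionX W x) (hΔ : W.Δ < 0) (htam : Odd W.tamagawaProduct)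
    (hr : W.analyticRank = 0) (hbsd : BSDp W 2) {q : ℚ} (hq0 : q ≠ 0)
    (hL : W.entireLFunction 1 / (W.realPeriodRat : ℂ) = (q : ℂ))
    {β : AlgebraicClosure ℚ} (hβ : aeval β W.twoTorsionPolynomial.toPoly = 0) :
    W.selmerGroup 2 = ⊥ ↔ ¬ 2 ∣ Nat.card (ClassGroup (𝓞 ↥(IntermediateField.adjoin ℚ ({β} : Set (AlgebraicClosure ℚ))))) := by
  rw [← padicValRat_lValue_eq_zero_iff_not_two_dvd_card_classGroup_adjoin W hYY2 hord ht hΔ htam hr hbsd hq0 hL hβ]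
  exact ⟨fun hSel => padicValRat_lValue_eq_zero_of_bsdp_two_of_selmerGroup_eq_bot W hbsd hr ht htam hSel hL,
    fun hv => selmerGroup_two_eq_bot_of_bsdp W hbsd hr ht htam ⟨q, hq0, hL, hv⟩⟩

/-- **Zhai currency**: `ord₂ L^{alg}(W,1) ≠ 0` (`IsLAlg W x`, `x ≠ 0`; `Ω_∞ = Ω_W` on `Δ_W < 0`) ⟹ `2 ∣ h(ℚ(β))`, granted `BSD₂(W)` + `hYY2`.
[cite: Zhai2016, §1] [cite: YooYu2022, Thm. 1.6 with Thm. 1.4 / 1.10 / 1.11 (1)] [cite: Miller2011LMS, Def. 1.1] -/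
theorem two_dvd_card_classGroup_adjoin_of_bsdp_of_isLAlg_even (hYY2 : yooYu_card_selmerTwo_bounds_cubicTwoTorsionField)
    (hord : IsOrdinaryAt W 2) (ht : ∀ x : ℚ, ¬ HasRationalTwoTorsionX W x) (hΔ : W.Δ < 0) (htam : Odd W.tamagawaProduct)
    (hr : W.analyticRank = 0) (hbsd : BSDp W 2) {x : ℚ} (hx : IsLAlg W x) (hv : padicValRat 2 x ≠ 0)
    {β : AlgebraicClosure ℚ} (hβ : aeval β W.twoTorsionPolynomial.toPoly = 0) :
    2 ∣ Nat.card (ClassGroup (𝓞 ↥(IntermediateField.adjoin ℚ ({β} : Set (AlgebraicClosure ℚ))))) :=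
  two_dvd_card_classGroup_adjoin_of_bsdp_of_padicValRat_lValue_ne_zero W hYY2 hord ht hΔ htam hr hbsd
    (lValue_div_realPeriodRat_eq_of_isLAlg_of_Δ_neg W hΔ hx) hv hβ

/-- **Zhai currency, dichotomy**: for `IsLAlg W x` with `x ≠ 0`: `ord₂ x = 0 ⟺ 2 ∤ h(ℚ(β))`, granted `BSD₂(W)` + `hYY2`.
[cite: Zhai2016, §1] [cite: YooYu2022, Thm. 1.6 with Thm. 1.4 / 1.10 / 1.11 (1)] [cite: Miller2011LMS, Def. 1.1] -/
theorem padicValRat_isLAlg_eq_zero_iff_not_two_dvd_card_classGroup_adjoin (hYY2 : yooYu_card_selmerTwo_bounds_cubicTwoTorsionField)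
    (hord : IsOrdinaryAt W 2) (ht : ∀ x : ℚ, ¬ HasRationalTwoTorsionX W x) (hΔ : W.Δ < 0) (htam : Odd W.tamagawaProduct)
    (hr : W.analyticRank = 0) (hbsd : BSDp W 2) {x : ℚ} (hx : IsLAlg W x) (hx0 : x ≠ 0)
    {β : AlgebraicClosure ℚ} (hβ : aeval β W.twoTorsionPolynomial.toPoly = 0) :
    padicValRat 2 x = 0 ↔ ¬ 2 ∣ Nat.card (ClassGroup (𝓞 ↥(IntermediateField.adjoin ℚ ({β} : Set (AlgebraicClosure ℚ))))) :=
  padicValRat_lValue_eq_zero_iff_not_two_dvd_card_classGroup_adjoin W hYY2 hord ht hΔ htam hr hbsd hx0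
    (lValue_div_realPeriodRat_eq_of_isLAlg_of_Δ_neg W hΔ hx) hβ

end Parity

end Summit.BirchSwinnertonDyer.BirchSwinnertonDyer.Theorems.AlignedTransportAtTwoCubicClassNumberParityOfLValue

end
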